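import Literature.AlgebraicGeometry.Motives.MixedHodgeStructureAbelian
import HarnessLib

/-!
# `Gr^W_k` is an exact functor on mixed Hodge structures

Cattani–El Zein–Griffiths–Lê, *Hodge Theory*, Cor. 3.2.21 (ii) (p. 161): "The functor `Gr^W_n` from
the category of MHS to the category `A ⊗ ℚ` HS of weight `n` is exact" — Deligne, *Théorie de Hodge
II*, Thm. 2.3.5 (iv) («Les foncteurs `Gr_W^n` … sont exacts»). Both follow from the strictness of
morphisms for `W` (Cor. 3.2.21 (i); the tree's `MixedHodgeStructure.Hom.isStrict`, file
`MixedHodgeStructureStrictProofs.lean`) applied to the kernel and cokernel of a morphism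
(`MixedHodgeStructureAbelian.lean`: `Hom.ker`, `Hom.coker`, `Hom.cokerMkQ`). This file proves, for a
morphism `f : H₁ → H₂` of mixed `ℚ`-Hodge structures and every `k`, with `Gr^W_k(f) = Hom.grMap f k`
(`MixedHodgeStructure.lean`):

* `Hom.grMap_mk_eq_zero_iff` — the class of `x ∈ W_k H₁` dies under `Gr^W_k(f)` iff
  `x ∈ (Ker f ∩ W_k) + W_{k-1}`;
* `Hom.exact_grMap_ker` — **`Gr^W_k(Ker f) → Gr^W_k(H₁) → Gr^W_k(H₂)` is exact**;
* `Hom.exact_grMap_cokerMkQ` — **`Gr^W_k(H₁) → Gr^W_k(H₂) → Gr^W_k(Coker f)` is exact**;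
* `Hom.grMap_injective`, `Hom.grMap_surjective` — `Gr^W_k` preserves monomorphisms and
  epimorphisms; `Hom.ker_grMap_eq_bot_iff`-type restatements `range_grMap_ker_subtype`,
  `ker_grMap_cokerMkQ`.

## References

* [CattaniElZeinGriffithsLe2014] E. Cattani et al. (eds.), *Hodge Theory* (2014), Cor. 3.2.21 (i)–(ii)
  (p. 161), Lemma 3.2.20.
* [DeligneHodgeII1971] P. Deligne, *Théorie de Hodge II*, Publ. Math. IHÉS 40 (1971), Thm. 2.3.5
  (iii)–(iv), 1.1.11.
-/

noncomputable section

open scoped TensorProduct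

namespace Literature.AlgebraicGeometry.Motives

namespace MixedHodgeStructure

namespace Hom

universe u v

variable {V : Type u} [AddCommGroup V] [Module ℚ V]
variable {V' : Type v} [AddCommGroup V'] [Module ℚ V']
variable {H₁ : MixedHodgeStructure V} {H₂ : MixedHodgeStructure V'}

/-- **The kernel of `Gr^W_k(f)` on representatives**: for `x ∈ W_k H₁`, `Gr^W_k(f) [x] = 0` iff
`x ∈ (Ker f ∩ W_k H₁) + W_{k-1} H₁` — "⇐" is trivial, "⇒" is the strictness `f(W_{k-1}) = W_{k-1} ∩ Im f`
(Cattani et al., Cor. 3.2.21 (i)). [cite: CattaniElZeinGriffithsLe2014, Cor. 3.2.21] -/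
theorem grMap_mk_eq_zero_iff (f : Hom H₁ H₂) (k : ℤ) (x : H₁.W k) :
    f.grMap k (Submodule.Quotient.mk x) = 0 ↔
      (x : V) ∈ (LinearMap.ker f.toLinearMap ⊓ H₁.W k) ⊔ H₁.W (k - 1) := by
  rw [grMap_mk, Submodule.Quotient.mk_eq_zero]
  change f.toLinearMap x ∈ H₂.W (k - 1) ↔ _
  constructor
  · intro hx
    have hx' : f.toLinearMap x ∈ (H₁.W (k - 1)).map f.toLinearMap := by
      rw [f.isStrict.map_W (k - 1)]
      exact ⟨hx, LinearMap.mem_range_self _ _⟩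
    obtain ⟨y, hy, hyx⟩ := hx'
    rw [show (x : V) = (x - y) + y by abel]
    refine Submodule.add_mem_sup (Submodule.mem_inf.2 ⟨?_, Submodule.sub_mem _ x.2
      (H₁.monotone_W (by omega) hy)⟩) hy
    rw [LinearMap.mem_ker, map_sub, hyx, sub_self]
  · intro hx
    obtain ⟨z, hz, y, hy, hzy⟩ := Submodule.mem_sup.1 hx
    rw [← hzy, map_add, LinearMap.mem_ker.1 hz.1, zero_add]
    exact f.map_W_le (k - 1) ⟨y, hy, rfl⟩

/-- **`Gr^W_k` is exact at the source: `Gr^W_k(Ker f) → Gr^W_k(H₁) → Gr^W_k(H₂)` is exact**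
(Cattani–El Zein–Griffiths–Lê, Cor. 3.2.21 (ii); Deligne, Hodge II, Thm. 2.3.5 (iv)), where
`Ker f ⊆ H₁` carries the induced filtrations (`Hom.ker`). [cite: CattaniElZeinGriffithsLe2014, Cor. 3.2.21 (ii)] -/
theorem exact_grMap_ker (f : Hom H₁ H₂) (k : ℤ) :
    Function.Exact (f.ker.subtype.grMap k) (f.grMap k) := by
  intro y
  induction y using Submodule.Quotient.induction_on with
  | _ x =>
    rw [grMap_mk_eq_zero_iff, Set.mem_range]
    constructor
    · intro hx
      obtain ⟨z, hz, w, hw, hzw⟩ := Submodule.mem_sup.1 hx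
      refine ⟨Submodule.Quotient.mk ⟨⟨z, hz.1⟩, hz.2⟩, ?_⟩
      rw [grMap_mk]
      refine (Submodule.Quotient.eq _).2 ?_
      change ((⟨z, hz.2⟩ : H₁.W k) - x : H₁.W k) ∈ subPiece H₁.W k
      change ((⟨z, hz.2⟩ - x : H₁.W k) : V) ∈ H₁.W (k - 1)
      rw [Submodule.coe_sub, Subtype.coe_mk, ← hzw, sub_add_cancel_left, Submodule.neg_mem_iff]
      exact hw
    · rintro ⟨z, hz⟩
      induction z using Submodule.Quotient.induction_on with
      | _ w =>
        rw [grMap_mk] at hz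
        have hxw := (Submodule.Quotient.eq _).1 hz
        change ((f.ker.subtype.restrictW k w - x : H₁.W k) : V) ∈ H₁.W (k - 1) at hxw
        rw [show (x : V) = (f.ker.subtype.restrictW k w : V) - ((f.ker.subtype.restrictW k w - x :
          H₁.W k) : V) by simp]
        refine Submodule.sub_mem_sup ⟨?_, (f.ker.subtype.restrictW k w).2⟩ hxw
        exact (w : f.ker.toSubmodule).2

/-- **`Gr^W_k` is exact at the target: `Gr^W_k(H₁) → Gr^W_k(H₂) → Gr^W_k(Coker f)` is exact**
(Cattani et al., Cor. 3.2.21 (ii); Deligne, Hodge II, Thm. 2.3.5 (iv)), `Coker f = V' / Im f` with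
the quotient filtrations (`Hom.coker`, `Hom.cokerMkQ`); uses the strictness `f(W_k) = W_k ∩ Im f`.
[cite: CattaniElZeinGriffithsLe2014, Cor. 3.2.21 (ii)] -/
theorem exact_grMap_cokerMkQ (f : Hom H₁ H₂) (k : ℤ) :
    Function.Exact (f.grMap k) (f.cokerMkQ.grMap k) := by
  intro y
  induction y using Submodule.Quotient.induction_on with
  | _ v =>
    rw [grMap_mk, Submodule.Quotient.mk_eq_zero, Set.mem_range]
    change (LinearMap.range f.toLinearMap).mkQ (v : V') ∈ (H₂.W (k - 1)).map
      (LinearMap.range f.toLinearMap).mkQ ↔ _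
    rw [← Submodule.mem_comap, Submodule.comap_map_eq, Submodule.ker_mkQ]
    constructor
    · intro hv
      obtain ⟨w, hw, r, hr, hwr⟩ := Submodule.mem_sup.1 hv
      have hr' : r ∈ (H₁.W k).map f.toLinearMap := by
        rw [f.isStrict.map_W k]
        refine ⟨?_, hr⟩
        rw [show r = (v : V') - w by rw [← hwr]; abel]
        exact Submodule.sub_mem _ v.2 (H₂.monotone_W (by omega) hw)
      obtain ⟨x, hx, hxr⟩ := hr'
      refine ⟨Submodule.Quotient.mk ⟨x, hx⟩, ?_⟩
      rw [grMap_mk]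
      refine (Submodule.Quotient.eq _).2 ?_
      change ((f.restrictW k ⟨x, hx⟩ - v : H₂.W k) : V') ∈ H₂.W (k - 1)
      rw [Submodule.coe_sub, coe_restrictW, Subtype.coe_mk, hxr,
        show r - (v : V') = -w by rw [← hwr]; abel, Submodule.neg_mem_iff]
      exact hw
    · rintro ⟨z, hz⟩
      induction z using Submodule.Quotient.induction_on with
      | _ x =>
        rw [grMap_mk] at hz
        have hxv := (Submodule.Quotient.eq _).1 hz
        change ((f.restrictW k x - v : H₂.W k) : V') ∈ H₂.W (k - 1) at hxv
        rw [Submodule.coe_sub, coe_restrictW] at hxv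
        rw [show (v : V') = -(f.toLinearMap x - v) + f.toLinearMap x by abel]
        exact Submodule.add_mem_sup (Submodule.neg_mem _ hxv) (LinearMap.mem_range_self _ _)

/-- **`Gr^W_k` preserves monomorphisms**: if `f` is injective, so is `Gr^W_k(f)` (the induced
filtration on a sub-object is the restricted one: strictness). [cite: CattaniElZeinGriffithsLe2014, Cor. 3.2.21 (ii)] -/
theorem grMap_injective (f : Hom H₁ H₂) (hf : Function.Injective f.toLinearMap) (k : ℤ) :
    Function.Injective (f.grMap k) := by
  rw [← LinearMap.ker_eq_bot, eq_bot_iff]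
  intro a ha
  induction a using Submodule.Quotient.induction_on with
  | _ x =>
    rw [LinearMap.mem_ker, grMap_mk_eq_zero_iff, LinearMap.ker_eq_bot.2 hf, bot_inf_eq,
      bot_sup_eq] at ha
    rw [Submodule.mem_bot, Submodule.Quotient.mk_eq_zero]
    exact ha

/-- **`Gr^W_k` preserves epimorphisms**: if `f` is surjective, so is `Gr^W_k(f)`
(`W_k H₂ = W_k H₂ ∩ Im f = f(W_k H₁)` by strictness). [cite: CattaniElZeinGriffithsLe2014, Cor. 3.2.21 (ii)] -/
theorem grMap_surjective (f : Hom H₁ H₂) (hf : Function.Surjective f.toLinearMap) (k : ℤ) :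
    Function.Surjective (f.grMap k) := by
  intro y
  induction y using Submodule.Quotient.induction_on with
  | _ v =>
    have hv : (v : V') ∈ (H₁.W k).map f.toLinearMap := by
      rw [f.isStrict.map_W k, LinearMap.range_eq_top.2 hf]
      exact ⟨v.2, Submodule.mem_top⟩
    obtain ⟨x, hx, hxv⟩ := hv
    refine ⟨Submodule.Quotient.mk ⟨x, hx⟩, ?_⟩
    rw [grMap_mk]
    congr 1
    exact Subtype.ext hxv

/-- The image of `Gr^W_k(Ker f → H₁)` is the kernel of `Gr^W_k(f)`. [cite: CattaniElZeinGriffithsLe2014, Cor. 3.2.21 (ii)] -/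
theorem range_grMap_ker_subtype (f : Hom H₁ H₂) (k : ℤ) :
    LinearMap.range (f.ker.subtype.grMap k) = LinearMap.ker (f.grMap k) :=
  LinearMap.exact_iff.1 (f.exact_grMap_ker k) |>.symm

/-- The kernel of `Gr^W_k(H₂ → Coker f)` is the image of `Gr^W_k(f)`. [cite: CattaniElZeinGriffithsLe2014, Cor. 3.2.21 (ii)] -/
theorem ker_grMap_cokerMkQ (f : Hom H₁ H₂) (k : ℤ) :
    LinearMap.ker (f.cokerMkQ.grMap k) = LinearMap.range (f.grMap k) :=
  LinearMap.exact_iff.1 (f.exact_grMap_cokerMkQ k)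

/-- `Gr^W_k(Ker f → H₁)` is injective (a sub-MHS carries the induced weight filtration).
[cite: CattaniElZeinGriffithsLe2014, Cor. 3.2.21 (ii)] -/
theorem grMap_ker_subtype_injective (f : Hom H₁ H₂) (k : ℤ) :
    Function.Injective (f.ker.subtype.grMap k) :=
  f.ker.subtype.grMap_injective (fun _ _ h => Subtype.ext h) k

/-- `Gr^W_k(H₂ → Coker f)` is surjective. [cite: CattaniElZeinGriffithsLe2014, Cor. 3.2.21 (ii)] -/
theorem grMap_cokerMkQ_surjective (f : Hom H₁ H₂) (k : ℤ) :
    Function.Surjective (f.cokerMkQ.grMap k) :=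
  f.cokerMkQ.grMap_surjective (Submodule.mkQ_surjective _) k

end Hom

end MixedHodgeStructure

end Literature.AlgebraicGeometry.Motives

end
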